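/-
Copyright (c) 2026. All rights reserved.
Released under Apache 2.0 license as described in the file LICENSE.
Authors: abc-iut cell, campaign-S prover seat abc-iut-S1 (gen 2).
-/
import Literature.LinearAlgebra.BaseChange.PiTensorRestrictScalars
import HarnessLib

/-!
# Naturality of the restriction-of-scalars comparison maps (factorwise maps and re-indexing)

Topic `LinearAlgebra/BaseChange`; namespace `Literature.LinearAlgebra.BaseChange`; THEOREMS ONLY
(companion of `PiTensorRestrictScalars.lean`).

For an `R`-algebra `S` and `S`-modules: the comparison map `θ : ⨂_R M_i → ⨂_S M_i` and its distributed form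
`e : ⨂_{a,R} (Π_v M_{a,v}) → Π_{v⃗} ⨂_{a,S} M_{a,v⃗ a}` commute

* with FACTORWISE maps: for `S`-linear `f_i : M_i → N_i`, `θ ∘ (⊗_R f_i) = (⊗_S f_i) ∘ θ`
  (`piTensorRestrictScalars_map`); for slotwise-diagonal maps `F_a (x)(v) = g_{a,v}(x v)` with `g_{a,v}`
  `S`-linear, `e (⊗_R F_a z) v⃗ = (⊗_S g_{a,v⃗ a}) (e z v⃗)` (`piTensorDistrib_map`);
* with RE-INDEXING along `σ : α ≃ β`: `θ ∘ reindex_R σ = reindex_S σ ∘ θ` (`piTensorRestrictScalars_reindex`),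
  and, for families constant in the tensor index, `e (reindex_R σ z) (v⃗ ∘ σ⁻¹) = reindex_S σ (e z v⃗)`
  (`piTensorDistrib_reindex`).

All proofs: two `R`-linear maps out of `⨂_R` agree on pure tensors (`PiTensorProduct.ext`). Source: N. Bourbaki,
*Algebra I*, Ch. II §3 no. 3 (functoriality of the canonical map (6) in the semi-linear maps `u ⊗ v`, p. 0345 of
the held text: "`(u ∘ u') ⊗ (v ∘ v') = (u ⊗ v) ∘ (u' ⊗ v')`") and no. 7 (22); here `n`-fold. Motivation (no
dependence): the indeterminacies (Ind1) (capsule permutations + factorwise automorphisms) and (Ind2) (factorwise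
`Ism`-automorphisms) of [IUTchIII] Thm. 3.11 (i) are typed on the `ℚ`-tensor packets; these lemmas carry them to
the completed `ℚ_p`-packets.
-/

noncomputable section

open PiTensorProduct Function
open scoped TensorProduct

namespace Literature.LinearAlgebra.BaseChange

universe uR uS uι uι' uM uα uβ uV

/-! ## 1. The single-packet map `θ` -/

section Theta

variable (R : Type uR) (S : Type uS) [CommSemiring R] [CommSemiring S] [Algebra R S]
variable {ι : Type uι} (M N : ι → Type uM)
  [∀ i, AddCommMonoid (M i)] [∀ i, Module S (M i)] [∀ i, Module R (M i)] [∀ i, IsScalarTower R S (M i)]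
  [∀ i, AddCommMonoid (N i)] [∀ i, Module S (N i)] [∀ i, Module R (N i)] [∀ i, IsScalarTower R S (N i)]

/-- **`θ` is natural in factorwise `S`-linear maps**: `θ (⊗_R f_i z) = (⊗_S f_i) (θ z)`.
[cite: BourbakiAlgebraI1989, Ch. II §3 no. 3 Prop. 2] -/
theorem piTensorRestrictScalars_map (f : ∀ i, M i →ₗ[S] N i) (z : ⨂[R] i, M i) :
    piTensorRestrictScalars R S N (PiTensorProduct.map (fun i ↦ (f i).restrictScalars R) z) =
      PiTensorProduct.map f (piTensorRestrictScalars R S M z) := by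
  suffices h : piTensorRestrictScalars R S N ∘ₗ PiTensorProduct.map (fun i ↦ (f i).restrictScalars R) =
      (PiTensorProduct.map f).restrictScalars R ∘ₗ piTensorRestrictScalars R S M from
    congrArg (fun g ↦ g z) (congrArg DFunLike.coe h)
  ext x
  simp [PiTensorProduct.map_tprod]

variable {κ : Type uι'}

/-- **`θ` is natural in re-indexing**: `θ (reindex_R σ z) = reindex_S σ (θ z)` for `σ : ι ≃ κ`.
[cite: BourbakiAlgebraI1989, Ch. II §3 no. 3 Prop. 2] -/
theorem piTensorRestrictScalars_reindex (σ : ι ≃ κ) (z : ⨂[R] i, M i) :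
    piTensorRestrictScalars R S (fun j ↦ M (σ.symm j)) (PiTensorProduct.reindex R M σ z) =
      PiTensorProduct.reindex S M σ (piTensorRestrictScalars R S M z) := by
  suffices h : piTensorRestrictScalars R S (fun j ↦ M (σ.symm j)) ∘ₗ (PiTensorProduct.reindex R M σ).toLinearMap =
      (PiTensorProduct.reindex S M σ).toLinearMap.restrictScalars R ∘ₗ piTensorRestrictScalars R S M from
    congrArg (fun g ↦ g z) (congrArg DFunLike.coe h)
  ext x
  simp [PiTensorProduct.reindex_tprod]

end Theta

/-! ## 2. The distributed map `e` -/

section Distrib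

variable (R : Type uR) (S : Type uS) [CommSemiring R] [CommSemiring S] [Algebra R S]
variable {α : Type uα} {V : Type uV}
variable (M N : α → V → Type uM)
  [∀ a v, AddCommMonoid (M a v)] [∀ a v, Module S (M a v)] [∀ a v, Module R (M a v)]
  [∀ a v, IsScalarTower R S (M a v)]
  [∀ a v, AddCommMonoid (N a v)] [∀ a v, Module S (N a v)] [∀ a v, Module R (N a v)]
  [∀ a v, IsScalarTower R S (N a v)]

/-- **`e` is natural in slotwise-DIAGONAL maps**: if `R`-linear maps `F_a : Π_v M_{a,v} → Π_v N_{a,v}` act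
componentwise through `S`-linear `g_{a,v}` (`F_a x v = g_{a,v} (x v)`) — e.g. `F_a = Π_v g_{a,v}` — then
`e (⊗_R F_a z) v⃗ = (⊗_{a,S} g_{a,v⃗ a}) (e z v⃗)`: the factorwise automorphisms of (Ind1)/(Ind2) commute with
the comparison. [cite: BourbakiAlgebraI1989, Ch. II §3 no. 7 (22)] -/
theorem piTensorDistrib_map (F : ∀ a, (∀ v, M a v) →ₗ[R] ∀ v, N a v) (g : ∀ a v, M a v →ₗ[S] N a v)
    (hF : ∀ a x v, F a x v = g a v (x v)) (z : ⨂[R] a, (∀ v, M a v)) (vA : α → V) :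
    piTensorDistrib R S N (PiTensorProduct.map F z) vA =
      PiTensorProduct.map (fun a ↦ g a (vA a)) (piTensorDistrib R S M z vA) := by
  suffices h : (LinearMap.proj vA ∘ₗ piTensorDistrib R S N) ∘ₗ PiTensorProduct.map F =
      (PiTensorProduct.map fun a ↦ g a (vA a)).restrictScalars R ∘ₗ
        (LinearMap.proj vA ∘ₗ piTensorDistrib R S M) from
    congrArg (fun f ↦ f z) (congrArg DFunLike.coe h)
  ext x
  simp [PiTensorProduct.map_tprod, hF]

/-- The same for a factorwise equivalence `PiTensorProduct.congr F` (the shape of the (Ind1)/(Ind2)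
generators `factorwise`/`summandwise` of the typed [IUTchIII] Thm. 3.11): if `F_a x v = g_{a,v} (x v)` with
`g_{a,v}` `S`-linear, then `e (congr F z) v⃗ = (⊗_{a,S} g_{a,v⃗ a}) (e z v⃗)`.
[cite: BourbakiAlgebraI1989, Ch. II §3 no. 7 (22)] -/
theorem piTensorDistrib_congr (F : ∀ a, (∀ v, M a v) ≃ₗ[R] ∀ v, N a v) (g : ∀ a v, M a v →ₗ[S] N a v)
    (hF : ∀ a x v, F a x v = g a v (x v)) (z : ⨂[R] a, (∀ v, M a v)) (vA : α → V) :
    piTensorDistrib R S N (PiTensorProduct.congr F z) vA =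
      PiTensorProduct.map (fun a ↦ g a (vA a)) (piTensorDistrib R S M z vA) :=
  piTensorDistrib_map R S M N (fun a ↦ (F a).toLinearMap) g hF z vA

variable {β : Type uβ} (M₀ : V → Type uM)
  [∀ v, AddCommMonoid (M₀ v)] [∀ v, Module S (M₀ v)] [∀ v, Module R (M₀ v)] [∀ v, IsScalarTower R S (M₀ v)]

/-- **`e` is natural in re-indexing the tensor slots** (family constant in the slot index, as for the
`(j+1)`-fold packets of ONE `1`-packet): for `σ : α ≃ β`,
`e (reindex_R σ z) (v⃗ ∘ σ⁻¹) = reindex_S σ (e z v⃗)` — every `w⃗ : β → V` being `(w⃗ ∘ σ) ∘ σ⁻¹`, this computes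
`e ∘ reindex_R σ` completely: the capsule permutations of (Ind1) commute with the comparison.
[cite: BourbakiAlgebraI1989, Ch. II §3 no. 7 (22)] -/
theorem piTensorDistrib_reindex (σ : α ≃ β) (z : ⨂[R] _a : α, (∀ v, M₀ v)) (vA : α → V) :
    piTensorDistrib R S (fun (_ : β) v ↦ M₀ v) (PiTensorProduct.reindex R (fun _ : α ↦ ∀ v, M₀ v) σ z)
        (fun b ↦ vA (σ.symm b)) =
      PiTensorProduct.reindex S (fun a ↦ M₀ (vA a)) σ (piTensorDistrib R S (fun (_ : α) v ↦ M₀ v) z vA) := by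
  induction z using PiTensorProduct.induction_on with
  | smul_tprod r x =>
    rw [LinearEquiv.map_smul, map_smul, Pi.smul_apply, PiTensorProduct.reindex_tprod, piTensorDistrib_tprod,
      map_smul, Pi.smul_apply, piTensorDistrib_tprod, ← LinearEquiv.coe_coe, LinearMap.map_smul_of_tower,
      LinearEquiv.coe_coe, PiTensorProduct.reindex_tprod]
  | add x y hx hy =>
    rw [map_add, map_add, Pi.add_apply, hx, hy, map_add, Pi.add_apply, map_add]

end Distrib

end Literature.LinearAlgebra.BaseChange

end
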